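import Literature.MathematicalPhysics.QuantumFieldTheory.Balaban1983to89.B9Cor36GpCubeLocLetter
import Literature.MathematicalPhysics.QuantumFieldTheory.Balaban1983to89.B9Thm39CinvSandwichQ

/-!
# `Balaban1983to89.B9ThmDLocDiffAlgebra` — THEOREM D (the [2]-DIFFERENCE OF LOCAL PROPAGATORS behind [B9] (3.97)) FOR THE RECORD'S LETTERS,
# FILE D1: THE COMMUTATOR IDENTITY — the localized difference `χ̃_□·Q′(G′(U)² − O_□²)Q′*·1_{□⁺}` is EXACTLY a sum of three products each containing
# either print's (3.89) letter `K(φ_□)G′_□(Ṽ_□)` of ONE plateau cut-off `φ_□` or the far factor `(1 − χ_□²)` (sub-row G-B9-LETTERS, GAPS G-B9-05, file D1)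

T. Bałaban, *Propagators for lattice gauge theories in a background field*, Commun. Math. Phys. **99** (1985) 389–434 [`Balaban1985BackgroundPropagators`,
"[B9]"]; [2] = T. Bałaban, *Regularity and decay of lattice Green's functions*, Commun. Math. Phys. **89** (1983) 571–597 [`Balaban1983RegularityDecay`]
(Sect. 5 Theorem p. 594, (5.8): «|δC_Λ(x,x′)| ≦ c₁e^{−δ₁(|x−x′| + dist(x,Λᶜ) + dist(x′,Λᶜ))}, δC_Λ = C_Λ − C_Ω», proved by the generalized random walk
representation (5.17) and the cancellation of the common walks (5.22), pp. 594–597; held `paper:balaban1983-cmp89-regularity-decay`); [4] = T. Bałaban, *Propagators and renormalization transformations for lattice gauge theories. II*, Commun. Math. Phys. **96** (1984)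
223–250 [`Balaban1984PropagatorsII`].

statement-level skeleton of published theorems with citation tags; proofs where landed; nothing here is a claim about the Yang–Mills mass gap

THE PRINT (held `paper:balaban1985-cmp99-background-propagators`, journal page = PDF page + 388).  p. 412: *«□̃Q′(G′²_{□₀} − G′²_□)Q′\*h_□C_□h_□. (3.97)  We have
proved in [2] that if we have a difference of propagators defined on two domains, then in an estimate of this difference we have, besides the usual factors
connected with propagators of a considered type, an exponential factor with a distance between localizations and a closest point where a change was made.
Such inequalities were proved using only the random walk expansions … the operators may differ outside □̃₀, and the distance from □̃ to □̃₀ᶜ is at least M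
(on L⁻ʲ-scale). This exponential can be estimated by (2δ₀M)⁻¹»*; p. 409 (3.88)–(3.89): *«(Δ′_a hλ)(x) = h(x)(Δ′_aλ)(x) − (K(h)λ)(x) … |(K(h_□)G′_□h_□λ)(x)| ≦
O(M⁻¹)e^{−δ₀(Lʲη)⁻¹|y−y′|}|λ|»*; p. 409 l. 1–5 (the cube operators `G′_□(U)`); pp. 395–396 (3.28)–(3.33) (gauge covariance «G′(U^u) = R(u)G′(U)R(u⁻¹)»).

WHY THIS FILE (cell `lit-balaban`, sub-row G-B9-LETTERS; GAPS G-B9-05 «Theorem D» = the one analytic input of p21's M5.6 (`B9Thm39CinvAtCoverLargeDefect.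
cinv_cover_large_defect`, binder `hD`) not in the tree; seat p21 g35, design `lit-balaban-p21/THEOREM-D-DESIGN-p21.md`).  M5.6 displays, per cover cube `□`,
`hD` = a block majorant of the LOCALIZED difference `χ̃_□·[X(O) − X(O_□)]·1_{□⁺}`, `X(T) = Q′(U)T²Q′*(U)`, between the member's letter `O = G′(U)` and M5.2-E's
localized cube letter `O_□ = χ_□R(u)⁻¹G′_□(Ṽ_□)R(u)χ_□` (p33's `locLetterY`).  Print proves such differences by the random-walk representations of BOTH operators and the cancellation of their common
walks ([2] Sect. 5, (5.22)).  THIS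
LINE OF FILES (D1–D5) proves `hD` WITHOUT a second expansion, from ONE exact commutator identity (this file), the (3.89) mechanism for ONE C^∞ plateau cut-off
`φ_□` (files D2–D3), and the decay of the two letters (file D4).  The identity: with `Γ = R(u)`, `Ō = Γ⁻¹G′_□(Ṽ)Γ`, `Δ₁ = Δ′_a(U)`, `Δ₂ = Γ⁻¹Δ′_{a,□}(Ṽ)Γ`, `P = M_φ`,
and ONLY the laws `OΔ₁ = 1`, `Δ₂Ō = 1`, `Δ₁P = Δ₂P` (the rows of the two operators agree wherever `φ`'s stencil reaches):
`O − Ō = O(1 − P) − (1 − P)Ō + O·[P, Δ₂]·Ō`, hence `O² − Ō² = O²(1 − P) − (1 − P)Ō² + O(O·KŌ + KŌ·Ō)` with `KŌ = Γ⁻¹(K(φ)(Ṽ)G′_□(Ṽ))Γ` — print's (3.89)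
letter at the cut-off `φ` — and the sandwich `χ̃ … 1_{□⁺}` (`φ = 1` there) kills the first two terms; `O_□² ↦ Ō²` costs `Γ⁻¹G′_□(1 − χ_□²)G′_□Γ` (`χ_□ = 1` near
`□̃ ∪ □⁺`).  (The naive resolvent form `O(Δ₂ − Δ₁)Ō` is avoided on purpose: in sup-operator norms `‖Δ₂ − Δ₁‖·‖Ō‖ ~ L^{2j}` is not member-uniform; the commutator
`[M_φ, Δ₂]` is first order in `∂φ` plus zeroth order in `∂²φ`, which (3.42)₀,₁ of `G′_□` turn into `O(M⁻¹)` — exactly (3.89).)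

CITATION HEADER (lean-in-tree rule).  REUSED BY NAME: p33 `B9Cor36GpCubeLocLetter` (`locLetterY`, `deltaPrimeAY_eq_conj`, `conjY_inv_mul_conjY`,
`conjY_mul_conjY_inv`, `cutMulY_mul_conjY`); r05 `B9CubeLettersOpsL0` (`deltaPrimeACubeY`, `GpCubeY`, `deltaPrimeACubeY_mul_GpCubeY`); def-Y
`Node00.OpsYDeltaPrimeA` (`GpY`, `GpY_mul_deltaPrimeAY`), `Node00.OpsYDeltaA` (`XY`, `QpY`, `QpsY`, `trLiftY_apply`), `Node00.OpsYGauge` (`conjY`, `gSiteY`,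
`gaugeY`, `IsGaugeLawS`); p38 `B9Thm37CubeCoverCommutators` (`cutMulY`, `KhY`, `deltaPrimeAY_mul_cutMulY`); p21 M5.6 FILE 3b `B9Thm39CinvSandwichQ.QpsY_apply`,
`B9Eq3104CutoffCommutatorSizes.qpK_ne_zero_imp`.  No existing module is modified.

WHAT THIS FILE PROVES (THEOREMS only; 0 `def`, 0 sorry, standard axioms; nothing of [B9]'s analysis asserted — pure algebra of the letters).
* §1 (any ring) `sub_eq_comm_form` ((i) above), `mul_self_sub_mul_self_eq_comm_form` ((ii)), `sandwich_mul_self_sub_eq` ((iii): the sandwich kills the cut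
  terms), `conj_sandwich_cutoff_sq` (`Cl·(ŌŌ − O_cO_c)·Cr = Cl·Γ⁻¹G(1 − C²)GΓ·Cr`), `comm_conj_eq` (`[P, Γ⁻¹ΔcΓ] = Γ⁻¹[P, Δc]Γ` for `P` commuting with `Γ^{±1}`).
* §2 (def-Y's letters, any transporter letter with the gauge law `IsGaugeLawS`) ★★ `cutMulY_GpY_sq_sub_locLetterY_sq_cutMulY` — THE IDENTITY OF RECORD:
  `M_{χl}·(G′(U)G′(U) − O_□O_□)·M_{χr} = M_{χl}·[G′(U)G′(U)·Γ⁻¹R_φΓ + G′(U)·Γ⁻¹R_φG′_□(Ṽ)Γ + Γ⁻¹G′_□(Ṽ)(1 − M_χM_χ)G′_□(Ṽ)Γ]·M_{χr}`,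
  `R_φ = K(φ)(Ṽ)·G′_□(Ṽ)` (p38's `KhY i parS φ Ṽ * GpCubeY i □ parS Ṽ`), from: `IsUnit Δ′_a(U)`, `IsUnit Δ′_{a,□}(Ṽ)`, the row laws `Δ′_a(U^u)M_φ = Δ′_{a,□}(Ṽ)M_φ`
  and `M_φΔ′_{a,□}(Ṽ) − Δ′_{a,□}(Ṽ)M_φ = K(φ)(Ṽ)` (discharged geometrically in file D2), and the plateau relations `χl·(1 − φ) = 0 = χr·(1 − φ)`, `χl·χ = χl`,
  `χ·χr = χr`.
* §3 (the block letter) `cutMulY_comp_QpY`, `QpsY_comp_cutMulY` (block cut-offs pass through `Q′(U)`, `Q′*(U)` as the site cut-offs `f ∘ Δ(·)`: `Q′` is block-local),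
  ★ `cutMulY_XY_sub_XY_cutMulY` and its real-scalar, scaled form ★ `smul_cutMulY_XY_sub_XY_cutMulY_restrictScalars`:
  `s•(M_{fl}·(X(O) − X(O_c))·M_{fr}) = Q′(U) ∘ (s•M_{fl∘Δ}(OO − O_cO_c)M_{fr∘Δ}) ∘ Q′*(U)` — the shape M5.6 FILE 3b's `hasMajorant_conj_QpY_sandwich_QpsY` consumes.

HONEST SCOPE.  Algebra only: no estimate, no geometry, no choice of `φ`; the row laws and plateau relations are HYPOTHESES here (files D2–D5 discharge them at
the (3.35) datum).  Count-neutral; nothing continuum, nothing about OS axioms or the mass gap.  No `sorry`, no `axiom`, no `instance`, no `notation`.  NEW file.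
Net new unproved facts: 0.  Seat `lit-balaban-p21` gen 35, 2026-08-28; `--supports stmt-QuantumFields-19200`.
-/

noncomputable section

namespace Literature.MathematicalPhysics.QuantumFieldTheory.Balaban1983to89.B9ThmDLocDiffAlgebra

open Node00
open B6Geom246MultiLevelBox (blkOf)
open B6KLevelCensusIndexV1 (KIdx)
open B6Cover236MultiLevelBlocks (cubes)
open B9Eq39Adjoint (R R_smul)
open B9CubeLettersOpsL0 (deltaPrimeACubeY GpCubeY deltaPrimeACubeY_mul_GpCubeY GpCubeY_mul_deltaPrimeACubeY)
open B9Thm37CubeCoverCommutators (cutMulY cutMulY_apply cutMulY_mul cutMulY_one KhY deltaPrimeAY_mul_cutMulY)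
open B9Cor36GpCubeLocLetter (locLetterY locLetterY_def deltaPrimeAY_eq_conj conjY_inv_mul_conjY conjY_mul_conjY_inv cutMulY_mul_conjY)
open B9Thm39CinvSandwichQ (QpsY_apply)
open B9Eq3104CutoffCommutatorSizes (qpK_ne_zero_imp)

variable {d ℓ : ℕ} {hd : 1 ≤ d + 1} {hL : Odd (ℓ + 1) ∧ 1 < ℓ + 1} {b₀ b₁ : ℝ}
variable {𝔸 : Type} [NormedRing 𝔸] [NormedAlgebra ℂ 𝔸] [CompleteSpace 𝔸]

/-! ## §1 The commutator identity in any ring -/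

section Ring

variable {𝓡 : Type*} [Ring 𝓡]

/-- ★ **`O − Ō = O(1 − P) − (1 − P)Ō + O·[P, Δ₂]·Ō`** from `OΔ₁ = 1`, `Δ₂Ō = 1`, `Δ₁P = Δ₂P` (two one-sided inverses whose operators agree on the rows reached
by `P`). [cite: Balaban1985BackgroundPropagators, (3.97) p.412 («the operators may differ outside □̃₀»), (3.88) p.409; Balaban1983RegularityDecay, Sect. 5 Thm (5.8) p.594 (statement type; derivation ours)] -/
theorem sub_eq_comm_form {O Ob Δ₁ Δ₂ P : 𝓡} (h1 : O * Δ₁ = 1) (h2 : Δ₂ * Ob = 1) (hP : Δ₁ * P = Δ₂ * P) :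
    O - Ob = O * (1 - P) - (1 - P) * Ob + O * (P * Δ₂ - Δ₂ * P) * Ob := by
  have e1 : O * (P * Δ₂ - Δ₂ * P) * Ob = O * P - P * Ob := by
    rw [mul_sub, sub_mul]
    congr 1
    · rw [mul_assoc O (P * Δ₂) Ob, mul_assoc P Δ₂ Ob, h2, mul_one]
    · rw [← hP, ← mul_assoc O Δ₁ P, h1, one_mul]
  rw [e1]; noncomm_ring

/-- ★ **`OO − ŌŌ = OO(1 − P) − (1 − P)ŌŌ + O(O·K + K·Ō)Ō`**, `K = [P, Δ₂]`, from the same three laws.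
[cite: Balaban1985BackgroundPropagators, (3.97) p.412, (3.88) p.409; Balaban1983RegularityDecay, Sect. 5 Thm (5.8) p.594 (statement type; derivation ours)] -/
theorem mul_self_sub_mul_self_eq_comm_form {O Ob Δ₁ Δ₂ P : 𝓡} (h1 : O * Δ₁ = 1) (h2 : Δ₂ * Ob = 1) (hP : Δ₁ * P = Δ₂ * P) :
    O * O - Ob * Ob = O * O * (1 - P) - (1 - P) * (Ob * Ob) + O * (O * (P * Δ₂ - Δ₂ * P) + (P * Δ₂ - Δ₂ * P) * Ob) * Ob := by
  have h := sub_eq_comm_form h1 h2 hP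
  calc O * O - Ob * Ob = O * (O - Ob) + (O - Ob) * Ob := by noncomm_ring
    _ = O * (O * (1 - P) - (1 - P) * Ob + O * (P * Δ₂ - Δ₂ * P) * Ob) +
          (O * (1 - P) - (1 - P) * Ob + O * (P * Δ₂ - Δ₂ * P) * Ob) * Ob := by rw [← h]
    _ = _ := by noncomm_ring

/-- ★ **THE SANDWICH KILLS THE CUT TERMS**: if `Cl(1 − P) = 0 = (1 − P)Cr` then `Cl(OO − ŌŌ)Cr = Cl·O(O·K + K·Ō)Ō·Cr`.
[cite: Balaban1985BackgroundPropagators, (3.97) p.412 («the distance from □̃ to □̃₀ᶜ is at least M»); derivation ours] -/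
theorem sandwich_mul_self_sub_eq {O Ob Δ₁ Δ₂ P Cl Cr : 𝓡} (h1 : O * Δ₁ = 1) (h2 : Δ₂ * Ob = 1) (hP : Δ₁ * P = Δ₂ * P)
    (hl : Cl * (1 - P) = 0) (hr : (1 - P) * Cr = 0) :
    Cl * (O * O - Ob * Ob) * Cr = Cl * (O * (O * (P * Δ₂ - Δ₂ * P) + (P * Δ₂ - Δ₂ * P) * Ob) * Ob) * Cr := by
  rw [mul_self_sub_mul_self_eq_comm_form h1 h2 hP]
  have e : Cl * (O * O * (1 - P) - (1 - P) * (Ob * Ob) + O * (O * (P * Δ₂ - Δ₂ * P) + (P * Δ₂ - Δ₂ * P) * Ob) * Ob) * Cr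
      = Cl * O * O * ((1 - P) * Cr) - Cl * (1 - P) * (Ob * Ob) * Cr + Cl * (O * (O * (P * Δ₂ - Δ₂ * P) + (P * Δ₂ - Δ₂ * P) * Ob) * Ob) * Cr := by
    noncomm_ring
  rw [e, hl, hr, mul_zero, zero_mul, zero_mul, sub_zero, zero_add]

/-- ★ **THE CUT-OFF COSTS `Γ⁻¹G(1 − C²)GΓ`**: with `Γ·Γi = 1`, `C` commuting with `Γ`, `Γi`, `Cl·C = Cl`, `C·Cr = Cr`:
`Cl·((ΓiGΓ)(ΓiGΓ) − (CΓiGΓC)(CΓiGΓC))·Cr = Cl·ΓiG(1 − CC)GΓ·Cr`. [cite: Balaban1985BackgroundPropagators, p.409 l.1–5 (the cube operators), (3.97) p.412; derivation ours] -/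
theorem conj_sandwich_cutoff_sq {G Γ Γi C Cl Cr : 𝓡} (hΓ : Γ * Γi = 1) (hCΓ : C * Γ = Γ * C) (hl : Cl * C = Cl) (hr : C * Cr = Cr) :
    Cl * (Γi * G * Γ * (Γi * G * Γ) - C * Γi * G * Γ * C * (C * Γi * G * Γ * C)) * Cr = Cl * (Γi * G * (1 - C * C) * G * Γ) * Cr := by
  have hΓC : Γ * C * C * Γi = C * C := by
    calc Γ * C * C * Γi = C * C * (Γ * Γi) := by rw [← hCΓ, mul_assoc C Γ C, ← hCΓ]; noncomm_ring
      _ = C * C := by rw [hΓ, mul_one]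
  have eA : Cl * (Γi * G * Γ * (Γi * G * Γ)) * Cr = Cl * Γi * G * (Γ * Γi) * G * Γ * Cr := by noncomm_ring
  have eB : Cl * (C * Γi * G * Γ * C * (C * Γi * G * Γ * C)) * Cr = (Cl * C) * Γi * G * (Γ * C * C * Γi) * G * Γ * (C * Cr) := by noncomm_ring
  rw [mul_sub, sub_mul, eA, eB, hΓ, hl, hr, hΓC]; noncomm_ring

/-- `[P, ΓiΔcΓ] = Γi[P, Δc]Γ` when `P` commutes with `Γ` and `Γi`. [cite: Balaban1985BackgroundPropagators, (3.28)–(3.33) pp.395–396 (gauge covariance), bookkeeping] -/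
theorem comm_conj_eq {Δc Γ Γi P : 𝓡} (hPΓ : P * Γ = Γ * P) (hPΓi : P * Γi = Γi * P) :
    P * (Γi * Δc * Γ) - Γi * Δc * Γ * P = Γi * (P * Δc - Δc * P) * Γ := by
  rw [← mul_assoc, ← mul_assoc, hPΓi, mul_assoc (Γi * Δc) Γ P, ← hPΓ, ← mul_assoc]; noncomm_ring

end Ring

/-! ## §2 The identity at def-Y's letters -/

section Letters

variable (i : KIdx d ℓ hd hL b₀ b₁) (q : ↥(cubes (toKT i).D.toDomains)) {parS : SiteParY 𝔸 i}

/-- ★★ **THEOREM D's IDENTITY OF RECORD** — the localized difference of the squares of the member's letter `G′(U)` and of the localized cube letter `O_□`,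
between two site cut-offs `χl`, `χr` on which the plateau cut-off `φ` and the cube cut-off `χ` equal `1`:
`M_{χl}(G′(U)G′(U) − O_□O_□)M_{χr} = M_{χl}[G′(U)G′(U)·Γ⁻¹R_φΓ + G′(U)·Γ⁻¹R_φG′_□(Ṽ)Γ + Γ⁻¹G′_□(Ṽ)(1 − M_χM_χ)G′_□(Ṽ)Γ]M_{χr}`, `R_φ = K(φ)(Ṽ)G′_□(Ṽ)`,
`Γ = R(u)`.  Inputs: the gauge law of `parS`, `IsUnit Δ′_a(U)`, `IsUnit Δ′_{a,□}(Ṽ)`, the two row laws of `φ` (file D2), the plateau relations.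
[cite: Balaban1985BackgroundPropagators, (3.97) p.412, (3.88)–(3.89) p.409, (3.28)–(3.33) pp.395–396; Balaban1983RegularityDecay, Sect. 5 Thm (5.8) p.594 (statement type); derivation ours] -/
theorem cutMulY_GpY_sq_sub_locLetterY_sq_cutMulY (hS : IsGaugeLawS i parS) (g : GaugeY 𝔸 i) (U V : CfgY 𝔸 i) (φ χ χl χr : SiteY i → ℝ)
    (hU : IsUnit (deltaPrimeAY i parS U)) (hunit : IsUnit (deltaPrimeACubeY i q parS V))
    (hrows : deltaPrimeAY i parS (gaugeY i g U) * cutMulY φ = deltaPrimeACubeY i q parS V * cutMulY φ)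
    (hK : cutMulY φ * deltaPrimeACubeY i q parS V - deltaPrimeACubeY i q parS V * cutMulY φ = KhY i parS φ V)
    (hlφ : ∀ z, χl z * φ z = χl z) (hrφ : ∀ z, φ z * χr z = χr z) (hlχ : ∀ z, χl z * χ z = χl z) (hrχ : ∀ z, χ z * χr z = χr z) :
    cutMulY χl * (GpY i parS U * GpY i parS U - locLetterY i q parS g χ V * locLetterY i q parS g χ V) * cutMulY χr =
      cutMulY χl * (GpY i parS U * GpY i parS U * (conjY (gSiteY i g)⁻¹ * (KhY i parS φ V * GpCubeY i q parS V) * conjY (gSiteY i g)) +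
        GpY i parS U * (conjY (gSiteY i g)⁻¹ * (KhY i parS φ V * GpCubeY i q parS V * GpCubeY i q parS V) * conjY (gSiteY i g)) +
        conjY (gSiteY i g)⁻¹ * (GpCubeY i q parS V * (1 - cutMulY χ * cutMulY χ) * GpCubeY i q parS V) * conjY (gSiteY i g)) * cutMulY χr := by
  set O : Module.End ℂ (SiteY i → 𝔸) := GpY i parS U with hO
  set G : Module.End ℂ (SiteY i → 𝔸) := GpCubeY i q parS V with hG
  set Γ : Module.End ℂ (SiteY i → 𝔸) := conjY (gSiteY i g) with hΓ
  set Γi : Module.End ℂ (SiteY i → 𝔸) := conjY (gSiteY i g)⁻¹ with hΓi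
  set P : Module.End ℂ (SiteY i → 𝔸) := cutMulY φ with hP
  set C : Module.End ℂ (SiteY i → 𝔸) := cutMulY χ with hC
  set Cl : Module.End ℂ (SiteY i → 𝔸) := cutMulY χl with hCl
  set Cr : Module.End ℂ (SiteY i → 𝔸) := cutMulY χr with hCr
  set Δ₁ : Module.End ℂ (SiteY i → 𝔸) := deltaPrimeAY i parS U with hΔ₁
  set Δc : Module.End ℂ (SiteY i → 𝔸) := deltaPrimeACubeY i q parS V with hΔc
  set Kφ : Module.End ℂ (SiteY i → 𝔸) := KhY i parS φ V with hKφ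
  -- the laws
  have hΓΓi : Γ * Γi = 1 := by rw [hΓ, hΓi]; exact conjY_mul_conjY_inv i (gSiteY i g)
  have hΓiΓ : Γi * Γ = 1 := by rw [hΓ, hΓi]; exact conjY_inv_mul_conjY i (gSiteY i g)
  have h1 : O * Δ₁ = 1 := GpY_mul_deltaPrimeAY i parS U hU
  have h2 : Γi * Δc * Γ * (Γi * G * Γ) = 1 := by
    calc Γi * Δc * Γ * (Γi * G * Γ) = Γi * (Δc * ((Γ * Γi) * G)) * Γ := by noncomm_ring
      _ = 1 := by rw [hΓΓi, one_mul, hΔc, hG, deltaPrimeACubeY_mul_GpCubeY i q parS V hunit, mul_one, hΓiΓ]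
  have hPΓ : P * Γ = Γ * P := by rw [hP, hΓ]; exact cutMulY_mul_conjY i _ _
  have hPΓi : P * Γi = Γi * P := by rw [hP, hΓi]; exact cutMulY_mul_conjY i _ _
  have hCΓ : C * Γ = Γ * C := by rw [hC, hΓ]; exact cutMulY_mul_conjY i _ _
  have hPlaw : Δ₁ * P = Γi * Δc * Γ * P := by
    rw [hΔ₁, deltaPrimeAY_eq_conj i hS g U, ← hΓ, ← hΓi, mul_assoc _ Γ P, ← hPΓ, ← mul_assoc, mul_assoc Γi _ P, hrows, ← mul_assoc,
      mul_assoc _ P Γ, hPΓ, ← mul_assoc]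
  have hKlaw : P * (Γi * Δc * Γ) - Γi * Δc * Γ * P = Γi * Kφ * Γ := by
    rw [comm_conj_eq hPΓ hPΓi, hK]
  have hl : Cl * (1 - P) = 0 := by
    rw [mul_sub, mul_one, hCl, hP, cutMulY_mul, sub_eq_zero]; exact congrArg cutMulY (funext fun z => (hlφ z).symm)
  have hr : (1 - P) * Cr = 0 := by
    rw [sub_mul, one_mul, hCr, hP, cutMulY_mul, sub_eq_zero]; exact congrArg cutMulY (funext fun z => (hrφ z).symm)
  have hl' : Cl * C = Cl := by rw [hCl, hC, cutMulY_mul]; exact congrArg cutMulY (funext hlχ)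
  have hr' : C * Cr = Cr := by rw [hCr, hC, cutMulY_mul]; exact congrArg cutMulY (funext hrχ)
  -- `Cl(OO − ŌŌ)Cr` and `Cl(ŌŌ − O_cO_c)Cr`
  have hA := sandwich_mul_self_sub_eq (O := O) (Ob := Γi * G * Γ) h1 h2 hPlaw hl hr
  have hB := conj_sandwich_cutoff_sq (G := G) (Cl := Cl) (Cr := Cr) hΓΓi hCΓ hl' hr'
  rw [locLetterY_def, ← hC, ← hΓi, ← hG, ← hΓ]
  calc Cl * (O * O - C * Γi * G * Γ * C * (C * Γi * G * Γ * C)) * Cr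
      = Cl * (O * O - Γi * G * Γ * (Γi * G * Γ)) * Cr + Cl * (Γi * G * Γ * (Γi * G * Γ) - C * Γi * G * Γ * C * (C * Γi * G * Γ * C)) * Cr := by
        rw [← add_mul, ← mul_add, sub_add_sub_cancel]
    _ = Cl * (O * (O * (P * (Γi * Δc * Γ) - Γi * Δc * Γ * P) + (P * (Γi * Δc * Γ) - Γi * Δc * Γ * P) * (Γi * G * Γ)) * (Γi * G * Γ)) * Cr +
          Cl * (Γi * G * (1 - C * C) * G * Γ) * Cr := by rw [hA, hB]
    _ = Cl * (O * (O * (Γi * Kφ * Γ) + Γi * Kφ * Γ * (Γi * G * Γ)) * (Γi * G * Γ)) * Cr + Cl * (Γi * G * (1 - C * C) * G * Γ) * Cr := by rw [hKlaw]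
    _ = Cl * (O * O * (Γi * Kφ * (Γ * Γi) * G * Γ) + O * (Γi * Kφ * (Γ * Γi) * G * (Γ * Γi) * G * Γ) + Γi * (G * (1 - C * C) * G) * Γ) * Cr := by
        noncomm_ring
    _ = Cl * (O * O * (Γi * (Kφ * G) * Γ) + O * (Γi * (Kφ * G * G) * Γ) + Γi * (G * (1 - C * C) * G) * Γ) * Cr := by
        rw [hΓΓi]; noncomm_ring

end Letters

/-! ## §3 The block letter: cut-offs through `Q′(U)`, `Q′*(U)` and the word `Q′ ∘ (…) ∘ Q′*` -/

section Block

variable (i : KIdx d ℓ hd hL b₀ b₁) (parS : SiteParY 𝔸 i) (U : CfgY 𝔸 i)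

/-- ★ **`Q′(U)` IS BLOCK-LOCAL**: a block cut-off after `Q′(U)` is the site cut-off `f ∘ Δ(·)` before it.
[cite: Balaban1985BackgroundPropagators, (3.21) p.394; Balaban1984PropagatorsII, (2.14) p.225] -/
theorem cutMulY_comp_QpY (f : BlkY i → ℝ) :
    cutMulY (𝔸 := 𝔸) f ∘ₗ QpY i parS U = QpY i parS U ∘ₗ cutMulY fun z : SiteY i => f (blkOf i.D.toDomains z) := by
  refine LinearMap.ext fun Λ => funext fun s => ?_
  show cutMulY f (QpY i parS U Λ) s = QpY i parS U (cutMulY (fun z : SiteY i => f (blkOf i.D.toDomains z)) Λ) s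
  rw [cutMulY_apply, QpY, trLiftY_apply, trLiftY_apply, Finset.smul_sum]
  refine Finset.sum_congr rfl fun z _ => ?_
  by_cases hq : qpK i s z = 0
  · rw [hq, Complex.ofReal_zero, zero_smul, zero_smul, smul_zero]
  · rw [cutMulY_apply, qpK_ne_zero_imp i hq, R_smul, smul_comm]

/-- ★ **`Q′*(U)` IS BLOCK-LOCAL**: a block cut-off before `Q′*(U)` is the site cut-off `f ∘ Δ(·)` after it.
[cite: Balaban1985BackgroundPropagators, (3.24)–(3.25) p.394; Balaban1984PropagatorsII, (2.16) p.225] -/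
theorem QpsY_comp_cutMulY (f : BlkY i → ℝ) :
    QpsY i parS U ∘ₗ cutMulY (𝔸 := 𝔸) f = (cutMulY fun z : SiteY i => f (blkOf i.D.toDomains z)) ∘ₗ QpsY i parS U := by
  refine LinearMap.ext fun lam => funext fun z => ?_
  show QpsY i parS U (cutMulY f lam) z = cutMulY (fun z : SiteY i => f (blkOf i.D.toDomains z)) (QpsY i parS U lam) z
  rw [cutMulY_apply, QpsY_apply, QpsY_apply, cutMulY_apply, R_smul]

/-- ★ **THE LOCALIZED DIFFERENCE OF THE BLOCK LETTERS IS THE `Q′(U)( · )Q′*(U)` WORD OF THE LOCALIZED DIFFERENCE OF THE SQUARES**: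
`M_{fl}·(X(O) − X(O_c))·M_{fr} = Q′(U) ∘ M_{fl∘Δ}(O(U)O(U) − O_c(U)O_c(U))M_{fr∘Δ} ∘ Q′*(U)`, `X(T) = Q′(U)T(U)T(U)Q′*(U)` (def-Y's `XY`).
[cite: Balaban1985BackgroundPropagators, (3.25) p.394–395, (3.95)–(3.97) pp.411–412] -/
theorem cutMulY_XY_sub_XY_cutMulY (O Oc : SiteOpY 𝔸 i) (fl fr : BlkY i → ℝ) :
    cutMulY (𝔸 := 𝔸) fl ∘ₗ (XY i parS O U - XY i parS Oc U) ∘ₗ cutMulY fr =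
      QpY i parS U ∘ₗ ((cutMulY (𝔸 := 𝔸) fun z : SiteY i => fl (blkOf i.D.toDomains z)) * ((O U * O U - Oc U * Oc U : Module.End ℂ (SiteY i → 𝔸))) *
        cutMulY (𝔸 := 𝔸) fun z : SiteY i => fr (blkOf i.D.toDomains z)) ∘ₗ QpsY i parS U := by
  simp only [XY, LinearMap.comp_sub, LinearMap.sub_comp, Module.End.mul_eq_comp, LinearMap.comp_assoc, QpsY_comp_cutMulY]
  rw [← LinearMap.comp_assoc _ (QpY i parS U) (cutMulY fl), cutMulY_comp_QpY, LinearMap.comp_assoc,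
    ← LinearMap.comp_assoc _ (QpY i parS U) (cutMulY fl), cutMulY_comp_QpY, LinearMap.comp_assoc]

/-- ★ the same over `ℝ` with the scale weight: `s•(M_{fl}|ℝ·((X O)|ℝ − (X O_c)|ℝ)·M_{fr}|ℝ) = Q′|ℝ ∘ (s•M_{fl∘Δ}(OO − O_cO_c)M_{fr∘Δ})|ℝ ∘ Q′*|ℝ` — the word M5.6
FILE 3b's `hasMajorant_conj_QpY_sandwich_QpsY` consumes, for M5.6's binder `hD` (`fl = χ̃_□`, `fr = 1_{□⁺}`, `s = η⁴`).
[cite: Balaban1985BackgroundPropagators, (3.25) p.394–395, (3.95)–(3.97) pp.411–412] -/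
theorem smul_cutMulY_XY_sub_XY_cutMulY_restrictScalars (O Oc : SiteOpY 𝔸 i) (fl fr : BlkY i → ℝ) (s : ℝ) :
    s • ((cutMulY (𝔸 := 𝔸) fl).restrictScalars ℝ * ((XY i parS O U).restrictScalars ℝ - (XY i parS Oc U).restrictScalars ℝ) *
        (cutMulY (𝔸 := 𝔸) fr).restrictScalars ℝ) =
      (QpY i parS U).restrictScalars ℝ ∘ₗ
        (s • ((cutMulY (𝔸 := 𝔸) fun z : SiteY i => fl (blkOf i.D.toDomains z)) * ((O U * O U - Oc U * Oc U : Module.End ℂ (SiteY i → 𝔸))) *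
          cutMulY (𝔸 := 𝔸) fun z : SiteY i => fr (blkOf i.D.toDomains z)).restrictScalars ℝ) ∘ₗ
        (QpsY i parS U).restrictScalars ℝ := by
  have h := cutMulY_XY_sub_XY_cutMulY i parS U O Oc fl fr
  rw [LinearMap.smul_comp, LinearMap.comp_smul]
  congr 1
  refine LinearMap.ext fun Λ => ?_
  have hΛ := congrArg (fun T => T Λ) h
  simpa only [LinearMap.comp_apply, Module.End.mul_apply, LinearMap.sub_apply, LinearMap.restrictScalars_apply] using hΛ

end Block

end Literature.MathematicalPhysics.QuantumFieldTheory.Balaban1983to89.B9ThmDLocDiffAlgebra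

end
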